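import Literature.Geometry.Lorentzian.TeukolskyRealAxisModeStabilityProofs
import Literature.Geometry.Lorentzian.RegularSingularVanishing
import Mathlib.Analysis.ODE.Gronwall
import HarnessLib

/-!
# A radial solution which is outgoing and flat at the horizon vanishes
# (Teixeira da Costa 2020, Prop. 3.8 (4) "injectivity", second half)

Part of the proof programme for the named fact
`Literature.Geometry.Lorentzian.Kerr.Costa2019_realAxisModeStability` (R. Teixeira da Costa,
Commun. Math. Phys. 378 (2020) 705–781 = arXiv:1910.02854 [Costa2019], Thm. 4.1). The injectivity
of Whiting's transformation `R ↦ ũ` (Prop. 3.8 (4)) is obtained in two steps: `ũ ≡ 0` forces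
the leading horizon coefficient `b₀ = [(r − r₊)^{s−ξ} R](r₊)` to vanish (Lemma 3.14, Erdélyi's
lemma; elsewhere), and — this file — **an outgoing radial solution with `b₀ = 0` is identically
zero** (`Costa2019.radial_eq_zero_of_horizon_flat`): in terms of `g = heunWeight · R`, which is
smooth across `r₊` and solves the confluent Heun equation `Δ g'' + P g' + Q g = 0`
(`TeukolskyRadialHeunForm.lean`), the point `r₊` is a regular singular point with indicial
exponents `0` and `s − 2ξ`, `Re(P(r₊)/(r₊ − r₋)) = 1 − s > 0`, so a solution smooth across `r₊`
with `g(r₊) = 0` vanishes near `r₊` (`Costa2019.eq_zero_of_regularSingular`, the Lyapunov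
argument of `RegularSingularVanishing.lean`), and then everywhere on `(r₊, ∞)` by uniqueness for
the linear ODE (Grönwall, `ODE_solution_unique_of_mem_Icc_right`). In the source this is the
sentence "standard asymptotic analysis [Olver]" identifying outgoing solutions with multiples of
`R^{[s]}_{𝓗⁺}`. Everything is proved; theorems only (D-0026).

## References
* R. Teixeira da Costa, CMP 378 (2020) 705–781, arXiv:1910.02854, Def. 2.4, Prop. 3.8 (4),
  Lemma 3.14. [Costa2019]
-/

noncomputable section

open Complex Set Filter Topology NNReal

namespace Literature.Geometry.Lorentzian.Kerr

namespace Costa2019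

/-! ### The Heun coefficients near the horizon -/

/-- `Re η = 0` for real `ω`. [cite: Costa2019, §3.2 (def-eta-xi-gamma)] -/
theorem innerExponent_re' (M a ω m : ℝ) : (innerExponent M a ω m).re = 0 := by
  unfold innerExponent
  generalize ((2 * M * rMinus M a * ω - a * m) / (rPlus M a - rMinus M a) : ℝ) = t
  simp [Complex.mul_re, Complex.I_re, Complex.I_im, Complex.ofReal_re, Complex.ofReal_im]

/-- **The indicial coefficient at `r₊` has positive real part.** For `x ≥ r₊` (`> r₋`),
`Re [P(x)/(x − r₋)] = (1 − s)(1 + (x − r₊)/(x − r₋)) ≥ 1 − s`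
(`P(r₊)/(r₊ − r₋) = 2ξ + 1 − s`, `Re ξ = Re η = 0`, `γ = −iω` imaginary).
[cite: Costa2019, §3.2 (g-bdry-sub: indicial exponents `0`, `s − 2ξ` at `r₊`)] -/
theorem re_heunP_div_ge {M a : ℝ} (hM : 0 < M) (ha : |a| < M) {s : ℝ} (hs : s ≤ 1) (ω m : ℝ)
    {x : ℝ} (hx : rPlus M a ≤ x) :
    1 - s ≤ (heunP M a s ω m x / ((x - rMinus M a : ℝ) : ℂ)).re := by
  have hq : rMinus M a < x := (IsSubextremal.rMinus_lt_rPlus ha).trans_le hx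
  have hq0 : 0 < x - rMinus M a := sub_pos.2 hq
  have hp0 : 0 ≤ x - rPlus M a := sub_nonneg.2 hx
  -- real and imaginary parts of the exponents
  have hξ := horizonExponent_re M a ω m
  have hη := innerExponent_re' M a ω m
  set ξ := horizonExponent M a ω m with hξd
  set η := innerExponent M a ω m with hηd
  have hP : heunP M a s ω m x / ((x - rMinus M a : ℝ) : ℂ) =
      (2 * ξ + 1 - s) + (2 * η + 1 - s) * (((x - rPlus M a) / (x - rMinus M a) : ℝ) : ℂ) +
        2 * (-I * ω) * ((x - rPlus M a : ℝ) : ℂ) := by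
    have hne : ((x - rMinus M a : ℝ) : ℂ) ≠ 0 := by exact_mod_cast hq0.ne'
    unfold heunP
    rw [delta_eq_mul ha.le]
    push_cast
    have hne' : (x : ℂ) - (rMinus M a : ℂ) ≠ 0 := by
      rw [← Complex.ofReal_sub]; exact hne
    field_simp
    ring
  have _ := hM
  have hre : ((2 * ξ + 1 - s) + (2 * η + 1 - s) * (((x - rPlus M a) / (x - rMinus M a) : ℝ) : ℂ) +
        2 * (-I * ω) * ((x - rPlus M a : ℝ) : ℂ)).re =
      (1 - s) + (1 - s) * ((x - rPlus M a) / (x - rMinus M a)) := by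
    simp only [Complex.add_re, Complex.mul_re, Complex.sub_re, Complex.ofReal_re,
      Complex.ofReal_im, Complex.one_re, Complex.neg_re, Complex.neg_im, Complex.I_re,
      Complex.I_im, Complex.mul_im, Complex.sub_im, hξ, hη, Complex.re_ofNat,
      Complex.im_ofNat]
    ring
  rw [hP, hre]
  have hratio : 0 ≤ (x - rPlus M a) / (x - rMinus M a) := div_nonneg hp0 hq0.le
  nlinarith [mul_nonneg (sub_nonneg.2 hs) hratio]

/-- `heunWeight ≠ 0` on `(r₊, ∞)`. [folklore] -/
theorem heunWeight_ne_zero (M a s ω m : ℝ) {r : ℝ} (hr : rPlus M a < r) :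
    heunWeight M a s ω m r ≠ 0 := by
  have hq : rMinus M a < r := (rMinus_le_rPlus M a).trans_lt hr
  have h1 : ((r - rMinus M a : ℝ) : ℂ) ≠ 0 := by exact_mod_cast (sub_pos.2 hq).ne'
  have h2 : ((r - rPlus M a : ℝ) : ℂ) ≠ 0 := by exact_mod_cast (sub_pos.2 hr).ne'
  unfold heunWeight
  refine mul_ne_zero (mul_ne_zero ?_ ?_) (Complex.exp_ne_zero _)
  · intro h; exact h1 (Complex.cpow_eq_zero_iff _ _ |>.1 h).1
  · intro h; exact h2 (Complex.cpow_eq_zero_iff _ _ |>.1 h).1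

/-- Continuity of `P/(x − r₋)` and `Q/(x − r₋)` on `(r₋, ∞)`. [folklore] -/
theorem continuousOn_heun_coeff_div {M a : ℝ} (s ω m lam : ℝ) :
    ContinuousOn (fun x => heunP M a s ω m x / ((x - rMinus M a : ℝ) : ℂ)) (Ioi (rMinus M a)) ∧
    ContinuousOn (fun x => heunQ a s ω m lam x / ((x - rMinus M a : ℝ) : ℂ)) (Ioi (rMinus M a)) := by
  have hden : Continuous fun x : ℝ => ((x - rMinus M a : ℝ) : ℂ) :=
    Complex.continuous_ofReal.comp (continuous_id.sub continuous_const)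
  have hne : ∀ x ∈ Ioi (rMinus M a), ((x - rMinus M a : ℝ) : ℂ) ≠ 0 := fun x hx => by
    exact_mod_cast (sub_pos.2 (mem_Ioi.1 hx)).ne'
  have hP : Continuous fun x : ℝ => heunP M a s ω m x := by
    unfold heunP
    refine ((continuous_const.mul (Complex.continuous_ofReal.comp
      (continuous_id.sub continuous_const))).add (continuous_const.mul hden)).add
      (continuous_const.mul (Complex.continuous_ofReal.comp ?_))
    exact continuous_iff_continuousAt.2 fun x => (hasDerivAt_delta M a x).continuousAt
  have hQ : Continuous fun x : ℝ => heunQ a s ω m lam x := by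
    unfold heunQ
    exact ((continuous_const.mul Complex.continuous_ofReal).sub continuous_const).sub
      continuous_const
  exact ⟨hP.continuousOn.div hden.continuousOn hne, hQ.continuousOn.div hden.continuousOn hne⟩

/-! ### Uniqueness for the Heun equation on `(r₊, ∞)` -/

/-- **Unique continuation to the right for `𝒯_r g = 0`.** If `g` solves
`Δ g'' + P g' + Q g = 0` classically on `(r₊, ∞)` and `g(r₁) = g'(r₁) = 0` at some `r₁ > r₊`,
then `g ≡ 0` on `[r₁, ∞)` (the equation is regular there: Grönwall / Picard–Lindelöf
uniqueness for the first-order system). [folklore] -/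
theorem heun_eq_zero_of_right {M a : ℝ} (ha : |a| < M) (s ω m lam : ℝ) {g g₁ g₂ : ℝ → ℂ}
    (hg : ∀ r, rPlus M a < r → HasDerivAt g (g₁ r) r ∧ HasDerivAt g₁ (g₂ r) r ∧
      (delta M a r : ℂ) * g₂ r + heunP M a s ω m r * g₁ r + heunQ a s ω m lam r * g r = 0)
    {r₁ : ℝ} (hr₁ : rPlus M a < r₁) (h0 : g r₁ = 0) (h1 : g₁ r₁ = 0) :
    ∀ r, r₁ ≤ r → g r = 0 := by
  intro r hr
  rcases eq_or_lt_of_le hr with h | hlt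
  · rw [← h]; exact h0
  -- the first-order system on `[r₁, r]`
  set A : ℝ → ℂ := fun t => heunP M a s ω m t / (delta M a t : ℂ) with hA
  set Bq : ℝ → ℂ := fun t => heunQ a s ω m lam t / (delta M a t : ℂ) with hBq
  set v : ℝ → ℂ × ℂ → ℂ × ℂ := fun t Y => (Y.2, -(A t * Y.2 + Bq t * Y.1)) with hv
  set Y : ℝ → ℂ × ℂ := fun t => (g t, g₁ t) with hY
  have hsub : Icc r₁ r ⊆ Ioi (rPlus M a) := fun t ht => hr₁.trans_le ht.1
  -- continuity of the coefficients on `[r₁, r]` and a common bound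
  have hΔc : Continuous fun t : ℝ => (delta M a t : ℂ) :=
    Complex.continuous_ofReal.comp
      (continuous_iff_continuousAt.2 fun x => (hasDerivAt_delta M a x).continuousAt)
  have hΔne : ∀ t ∈ Ioi (rPlus M a), (delta M a t : ℂ) ≠ 0 := fun t ht => by
    exact_mod_cast (delta_pos ha.le (mem_Ioi.1 ht)).ne'
  obtain ⟨hPc, hQc⟩ := continuousOn_heun_coeff_div (M := M) (a := a) s ω m lam
  have hden : Continuous fun x : ℝ => ((x - rMinus M a : ℝ) : ℂ) :=
    Complex.continuous_ofReal.comp (continuous_id.sub continuous_const)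
  have hAc : ContinuousOn A (Ioi (rPlus M a)) := by
    -- `A = [P/(x−r₋)] · (x−r₋)/Δ`
    have h1 : ContinuousOn (fun t => heunP M a s ω m t) (Ioi (rPlus M a)) := by
      have := hPc.mul hden.continuousOn
      refine (this.mono fun t ht => (rMinus_le_rPlus M a).trans_lt ht).congr fun t ht => ?_
      have hne : ((t - rMinus M a : ℝ) : ℂ) ≠ 0 := by
        exact_mod_cast (sub_pos.2 ((rMinus_le_rPlus M a).trans_lt ht)).ne'
      simp only [Pi.mul_apply]
      rw [div_mul_cancel₀ _ hne]
    exact h1.div hΔc.continuousOn hΔne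
  have hBc : ContinuousOn Bq (Ioi (rPlus M a)) := by
    have h1 : ContinuousOn (fun t => heunQ a s ω m lam t) (Ioi (rPlus M a)) := by
      have := hQc.mul hden.continuousOn
      refine (this.mono fun t ht => (rMinus_le_rPlus M a).trans_lt ht).congr fun t ht => ?_
      have hne : ((t - rMinus M a : ℝ) : ℂ) ≠ 0 := by
        exact_mod_cast (sub_pos.2 ((rMinus_le_rPlus M a).trans_lt ht)).ne'
      simp only [Pi.mul_apply]
      rw [div_mul_cancel₀ _ hne]
    exact h1.div hΔc.continuousOn hΔne
  obtain ⟨CA, hCA⟩ := isCompact_Icc.exists_bound_of_continuousOn (hAc.mono hsub)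
  obtain ⟨CB, hCB⟩ := isCompact_Icc.exists_bound_of_continuousOn (hBc.mono hsub)
  set K : ℝ≥0 := ⟨1 + |CA| + |CB|, by positivity⟩ with hK
  have hLip : ∀ t ∈ Ico r₁ r, LipschitzOnWith K (v t) univ := by
    intro t ht
    have htI : t ∈ Icc r₁ r := Ico_subset_Icc_self ht
    refine LipschitzOnWith.of_dist_le_mul fun Y₁ _ Y₂ _ => ?_
    rw [dist_eq_norm, dist_eq_norm]
    have e : v t Y₁ - v t Y₂ = ((Y₁ - Y₂).2, -(A t * (Y₁ - Y₂).2 + Bq t * (Y₁ - Y₂).1)) := by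
      simp only [hv, Prod.mk_sub_mk, Prod.snd_sub, Prod.fst_sub]
      ring_nf
    rw [e, Prod.norm_mk]
    have hn1 : ‖(Y₁ - Y₂).1‖ ≤ ‖Y₁ - Y₂‖ := norm_fst_le _
    have hn2 : ‖(Y₁ - Y₂).2‖ ≤ ‖Y₁ - Y₂‖ := norm_snd_le _
    have hK' : ((K : ℝ≥0) : ℝ) = 1 + |CA| + |CB| := rfl
    rw [hK']
    refine max_le ?_ ?_
    · calc ‖(Y₁ - Y₂).2‖ ≤ ‖Y₁ - Y₂‖ := hn2
        _ ≤ (1 + |CA| + |CB|) * ‖Y₁ - Y₂‖ := by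
            have : 0 ≤ (|CA| + |CB|) * ‖Y₁ - Y₂‖ := by positivity
            nlinarith
    · rw [norm_neg]
      calc ‖A t * (Y₁ - Y₂).2 + Bq t * (Y₁ - Y₂).1‖ ≤ ‖A t‖ * ‖(Y₁ - Y₂).2‖ + ‖Bq t‖ * ‖(Y₁ - Y₂).1‖ := by
            refine (norm_add_le _ _).trans ?_; rw [norm_mul, norm_mul]
        _ ≤ |CA| * ‖Y₁ - Y₂‖ + |CB| * ‖Y₁ - Y₂‖ :=
            add_le_add (mul_le_mul ((hCA t htI).trans (le_abs_self _)) hn2 (norm_nonneg _)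
              (abs_nonneg _))
              (mul_le_mul ((hCB t htI).trans (le_abs_self _)) hn1 (norm_nonneg _) (abs_nonneg _))
        _ ≤ (1 + |CA| + |CB|) * ‖Y₁ - Y₂‖ := by nlinarith [norm_nonneg (Y₁ - Y₂)]
  -- `Y` solves the system, `0` too
  have hYd : ∀ t ∈ Ico r₁ r, HasDerivWithinAt Y (v t (Y t)) (Ici t) t := by
    intro t ht
    have htp : rPlus M a < t := hr₁.trans_le ht.1
    obtain ⟨hd1, hd2, hode⟩ := hg t htp
    have hΔ : (delta M a t : ℂ) ≠ 0 := hΔne t htp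
    have hg₂ : g₂ t = -(A t * g₁ t + Bq t * g t) := by
      simp only [hA, hBq]
      field_simp
      linear_combination hode
    have h := hd1.prodMk hd2
    rw [hg₂] at h
    exact h.hasDerivWithinAt
  have hYc : ContinuousOn Y (Icc r₁ r) := by
    intro t ht
    have htp : rPlus M a < t := hr₁.trans_le ht.1
    obtain ⟨hd1, hd2, _⟩ := hg t htp
    exact (hd1.prodMk hd2).continuousAt.continuousWithinAt
  have hZd : ∀ t ∈ Ico r₁ r, HasDerivWithinAt (fun _ : ℝ => ((0 : ℂ), (0 : ℂ))) (v t ((0 : ℂ), (0 : ℂ)))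
      (Ici t) t := by
    intro t _
    have : v t ((0 : ℂ), (0 : ℂ)) = ((0 : ℂ), (0 : ℂ)) := by simp [hv]
    rw [this]
    exact (hasDerivAt_const t _).hasDerivWithinAt
  have hY0 : Y r₁ = ((0 : ℂ), (0 : ℂ)) := by simp [hY, h0, h1]
  have key := ODE_solution_unique_of_mem_Icc_right (v := v) (s := fun _ => univ) (K := K)
    hLip hYc hYd (fun _ _ => mem_univ _) continuousOn_const hZd (fun _ _ => mem_univ _) hY0
  have := key ⟨hlt.le, le_rfl⟩
  simp only [hY, Prod.mk.injEq] at this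
  exact this.1

/-! ### Flatness at the horizon forces vanishing -/

/-- **An outgoing radial solution which is flat at the horizon is identically zero** (the
second half of the injectivity statement Prop. 3.8 (4), cf. Lemma 3.14: outgoing solutions are
multiples of `R_{𝓗⁺} = (r − r₊)^{ξ−s}(b₀ + …)`, so `b₀ = 0` forces `R ≡ 0`). Precisely: if `R`
solves the radial Teukolsky ODE on `(r₊, ∞)` with `s < 1`, is outgoing at `𝓗⁺`
(`R (r−r₊)^{s−ξ}` smooth across `r₊`) and `R(r)(r − r₊)^{s−ξ} → 0` as `r → r₊⁺`, then `R ≡ 0`.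
[cite: Costa2019, Prop. 3.8 (4), Lemma 3.14, Def. 2.4] -/
theorem radial_eq_zero_of_horizon_flat {M a : ℝ} (hM : 0 < M) (ha : |a| < M) {s : ℝ}
    (hs : s < 1) {ω m lam : ℝ} {R : ℝ → ℂ} (hsol : IsRadialTeukolskySolution M a s ω m lam R)
    (hH : IsOutgoingAtHorizon M a s ω m R)
    (hflat : Tendsto (fun r => R r * ((r - rPlus M a : ℝ) : ℂ) ^ ((s : ℂ) - horizonExponent M a ω m))
      (𝓝[>] rPlus M a) (𝓝 0)) :
    ∀ r, rPlus M a < r → R r = 0 := by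
  have hgap : 0 < rPlus M a - rMinus M a := sub_pos.2 (IsSubextremal.rMinus_lt_rPlus ha)
  -- `g = heunWeight · R` is smooth across `r₊` …
  obtain ⟨ε, hε, F, hF, hgF⟩ := heunWeight_mul_smooth_at_horizon ha hH
  have hopen : IsOpen (Ioo (rPlus M a - ε) (rPlus M a + ε)) := isOpen_Ioo
  have hmem : rPlus M a ∈ Ioo (rPlus M a - ε) (rPlus M a + ε) := ⟨by linarith, by linarith⟩
  -- … and vanishes at `r₊`
  have hF0 : F (rPlus M a) = 0 := by
    have hFc : ContinuousAt F (rPlus M a) := (hF.continuousOn.continuousWithinAt hmem).continuousAt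
      (hopen.mem_nhds hmem)
    have h1 : Tendsto F (𝓝[>] rPlus M a) (𝓝 (F (rPlus M a))) :=
      hFc.tendsto.mono_left nhdsWithin_le_nhds
    -- `g → 0` from the right
    have hpre : ContinuousAt (fun r : ℝ => ((r - rMinus M a : ℝ) : ℂ) ^
        ((s : ℂ) - innerExponent M a ω m) * Complex.exp (I * ω * r)) (rPlus M a) := by
      refine ContinuousAt.mul ?_ ?_
      · exact (hasDerivAt_ofReal_sub_cpow (rMinus M a) _ (IsSubextremal.rMinus_lt_rPlus ha)).continuousAt
      · exact (Complex.continuous_exp.comp (continuous_const.mul Complex.continuous_ofReal)).continuousAt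
    have h2 : Tendsto (fun r => heunWeight M a s ω m r * R r) (𝓝[>] rPlus M a) (𝓝 0) := by
      have h3 := (hpre.tendsto.mono_left nhdsWithin_le_nhds).mul hflat
      rw [mul_zero] at h3
      refine h3.congr' ?_
      filter_upwards [self_mem_nhdsWithin] with r _
      simp only [heunWeight]
      ring
    have h4 : Tendsto F (𝓝[>] rPlus M a) (𝓝 0) := by
      refine h2.congr' ?_
      filter_upwards [Ioo_mem_nhdsGT (show rPlus M a < rPlus M a + ε by linarith)] with r hr
      exact hgF r hr
    exact tendsto_nhds_unique h1 h4
  -- the Heun equation for `g`, transported to `F` near `r₊`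
  obtain ⟨g₁, g₂, hge⟩ := heunEquation_of_isRadialTeukolskySolution hM ha hsol
  have hFd : ∀ r ∈ Ioo (rPlus M a - ε) (rPlus M a + ε), HasDerivAt F (deriv F r) r := fun r hr =>
    ((hF.differentiableOn (by simp)).differentiableAt (hopen.mem_nhds hr)).hasDerivAt
  have hF'cd : ContDiffOn ℝ ((⊤ : ℕ∞) : WithTop ℕ∞) (deriv F) (Ioo (rPlus M a - ε) (rPlus M a + ε)) :=
    (hF.deriv_of_isOpen hopen le_rfl)
  have hF'd : ∀ r ∈ Ioo (rPlus M a - ε) (rPlus M a + ε), HasDerivAt (deriv F) (deriv (deriv F) r) r :=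
    fun r hr => ((hF'cd.differentiableOn (by simp)).differentiableAt (hopen.mem_nhds hr)).hasDerivAt
  have hderivF : ∀ r ∈ Ioo (rPlus M a) (rPlus M a + ε), deriv F r = g₁ r ∧ deriv (deriv F) r = g₂ r := by
    intro r hr
    have hloc : (fun x => heunWeight M a s ω m x * R x) =ᶠ[𝓝 r] F := by
      filter_upwards [isOpen_Ioo.mem_nhds hr] with x hx using hgF x hx
    have e1 : deriv F r = g₁ r := by
      rw [← hloc.deriv_eq]; exact (hge r hr.1).1.deriv
    have hloc' : deriv F =ᶠ[𝓝 r] g₁ := by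
      filter_upwards [isOpen_Ioo.mem_nhds hr] with x hx
      have hlocx : (fun y => heunWeight M a s ω m y * R y) =ᶠ[𝓝 x] F := by
        filter_upwards [isOpen_Ioo.mem_nhds hx] with y hy using hgF y hy
      rw [← hlocx.deriv_eq]; exact (hge x hx.1).1.deriv
    have e2 : deriv (deriv F) r = g₂ r := by
      rw [hloc'.deriv_eq]; exact (hge r hr.1).2.1.deriv
    exact ⟨e1, e2⟩
  -- the coefficients `P/(x − r₋)`, `Q/(x − r₋)`
  set Ph : ℝ → ℂ := fun x => heunP M a s ω m x / ((x - rMinus M a : ℝ) : ℂ) with hPh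
  set Qh : ℝ → ℂ := fun x => heunQ a s ω m lam x / ((x - rMinus M a : ℝ) : ℂ) with hQh
  obtain ⟨hPc, hQc⟩ := continuousOn_heun_coeff_div (M := M) (a := a) s ω m lam
  obtain ⟨BQ₀, hBQ₀⟩ := (isCompact_Icc (a := rPlus M a) (b := rPlus M a + 1)).exists_bound_of_continuousOn
    (hQc.mono fun x hx => show rMinus M a < x from (IsSubextremal.rMinus_lt_rPlus ha).trans_le hx.1)
  set BQ : ℝ := max BQ₀ 0 with hBQ
  have hBQ0 : 0 ≤ BQ := le_max_right _ _
  -- the length `T`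
  set T : ℝ := min (ε / 2) (1 / (2 * (BQ + 1))) with hT
  have hT0 : 0 < T := lt_min (by linarith) (by positivity)
  have hTε : T ≤ ε / 2 := min_le_left _ _
  have hT1 : T ≤ 1 := by
    have h1 : 1 / (2 * (BQ + 1)) ≤ 1 := by
      rw [div_le_one (by positivity)]; linarith
    exact (min_le_right _ _).trans h1
  have hBT : BQ * T ≤ 1 / 2 := by
    have h1 : T ≤ 1 / (2 * (BQ + 1)) := min_le_right _ _
    calc BQ * T ≤ BQ * (1 / (2 * (BQ + 1))) := mul_le_mul_of_nonneg_left h1 hBQ0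
      _ ≤ 1 / 2 := by
          rw [mul_one_div, div_le_div_iff₀ (by positivity) (by norm_num)]
          nlinarith
  -- apply the regular-singular vanishing lemma to `F` on `[r₊, r₊ + T]`
  have hzero : ∀ x ∈ Icc (rPlus M a) (rPlus M a + T), F x = 0 := by
    refine eq_zero_of_regularSingular (P := Ph) (Q := Qh) (xl := (rPlus M a + rMinus M a) / 2)
      (xr := rPlus M a + ε) (c := 1 - s) hT0 (by linarith) (by linarith) (by linarith) hBQ0 hBT hF0
      (fun x hx => hFd x ⟨by linarith [hx.1], by linarith [hx.2]⟩)
      (fun x hx => hF'd x ⟨by linarith [hx.1], by linarith [hx.2]⟩)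
      (hF'cd.continuousOn.mono fun x hx => ⟨by linarith [hx.1], by linarith [hx.2]⟩)
      (hPc.mono fun x hx => show rMinus M a < x by
        have := hx.1; simp only [mem_Ioo] at hx; linarith)
      (hQc.mono fun x hx => show rMinus M a < x by
        have := hx.1; simp only [mem_Ioo] at hx; linarith)
      (fun x hx => re_heunP_div_ge hM ha hs.le ω m hx.1)
      (fun x hx => (hBQ₀ x ⟨hx.1, hx.2.trans (by linarith)⟩).trans (le_max_left _ _))
      fun x hx => ?_
    -- the equation `(x − r₊) F'' + Ph F' + Qh F = 0` on `(r₊, r₊ + T]`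
    have hxI : x ∈ Ioo (rPlus M a) (rPlus M a + ε) := ⟨hx.1, by linarith [hx.2]⟩
    obtain ⟨e1, e2⟩ := hderivF x hxI
    obtain ⟨_, _, hode⟩ := hge x hx.1
    have hq : 0 < x - rMinus M a := sub_pos.2 ((rMinus_le_rPlus M a).trans_lt hx.1)
    have hne : ((x - rMinus M a : ℝ) : ℂ) ≠ 0 := by exact_mod_cast hq.ne'
    rw [e1, e2, ← hgF x hxI]
    simp only [hPh, hQh]
    have hne' : (x : ℂ) - (rMinus M a : ℂ) ≠ 0 := by rw [← Complex.ofReal_sub]; exact hne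
    rw [delta_eq_mul ha.le] at hode
    push_cast at hode ⊢
    have key : ((x : ℂ) - rPlus M a) * g₂ x + heunP M a s ω m x / ((x : ℂ) - rMinus M a) * g₁ x +
        heunQ a s ω m lam x / ((x : ℂ) - rMinus M a) * (heunWeight M a s ω m x * R x) =
        (((x : ℂ) - rPlus M a) * ((x : ℂ) - rMinus M a) * g₂ x + heunP M a s ω m x * g₁ x +
          heunQ a s ω m lam x * (heunWeight M a s ω m x * R x)) / ((x : ℂ) - rMinus M a) := by
      field_simp
    rw [key, hode, zero_div]
  -- hence `R = 0` on `(r₊, r₊ + T]`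
  have hRT : ∀ r ∈ Ioc (rPlus M a) (rPlus M a + T), R r = 0 := by
    intro r hr
    have hrI : r ∈ Ioo (rPlus M a) (rPlus M a + ε) := ⟨hr.1, by linarith [hr.2]⟩
    have h1 : heunWeight M a s ω m r * R r = 0 := by rw [hgF r hrI]; exact hzero r ⟨hr.1.le, hr.2⟩
    rcases mul_eq_zero.1 h1 with h | h
    · exact absurd h (heunWeight_ne_zero M a s ω m hr.1)
    · exact h
  -- and on `[r₊ + T/2, ∞)` by uniqueness for the Heun equation
  set r₁ : ℝ := rPlus M a + T / 2 with hr₁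
  have hr₁p : rPlus M a < r₁ := by rw [hr₁]; linarith
  have hgzero : ∀ᶠ x in 𝓝 r₁, heunWeight M a s ω m x * R x = 0 := by
    filter_upwards [isOpen_Ioo.mem_nhds (show r₁ ∈ Ioo (rPlus M a) (rPlus M a + T) from
      ⟨hr₁p, by rw [hr₁]; linarith⟩)] with x hx
    rw [hRT x ⟨hx.1, hx.2.le⟩, mul_zero]
  have h0 : heunWeight M a s ω m r₁ * R r₁ = 0 := hgzero.self_of_nhds
  have h1 : g₁ r₁ = 0 := by
    have hd : HasDerivAt (fun x => heunWeight M a s ω m x * R x) 0 r₁ :=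
      (hasDerivAt_const r₁ (0 : ℂ)).congr_of_eventuallyEq hgzero
    exact (hge r₁ hr₁p).1.unique hd
  have hright := heun_eq_zero_of_right ha s ω m lam hge hr₁p h0 h1
  intro r hr
  rcases le_or_gt r r₁ with h | h
  · exact hRT r ⟨hr, h.trans (by rw [hr₁]; linarith)⟩
  · have h2 := hright r h.le
    rcases mul_eq_zero.1 h2 with h3 | h3
    · exact absurd h3 (heunWeight_ne_zero M a s ω m hr)
    · exact h3

end Costa2019

end Literature.Geometry.Lorentzian.Kerr

end
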